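import Summits.ValiantsHypothesis.ValiantsHypothesis.Theorems.LacunarySymmetroidMatrixDescartesFiniteSectorEtaKThreeSixSeven
import Summits.ValiantsHypothesis.ValiantsHypothesis.Theorems.LacunarySymmetroidMatrixDescartesFiniteSectorStampCeilingKThreeAll

/-!
# `MatrixDescartes` — line «finite»: CONJECTURE Σ ON THE WHOLE `K = 3` COLUMN (kernel, all `m ≥ 3`):
# `η(m,3) ≤ σ(m,3) = 2·n(m,2) = 2⌊(m²+6m+1)/4⌋`, i.e. `HypRootLawAt m 3 (2·((m²+6m+1)/4))`

HONEST FRAMING.  Object-search cell `pub-symmetroid`, seat val-sym-eng-3 g4.  HELPER of the crux item `stmt-ValiantsHypothesis-18050`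
(`Theses.LacunarySymmetroid.MatrixDescartes`, asymptotic in `K`) with NO closure claim.  The card `Lines/finite.md` (val-idea-6 g3) records
«Conjecture Σ: σ(m,K) = 2·n(m,K−1)» — the gap-rule SIEVE ceiling of the sector equals twice the postage-stamp number — certified by
enumeration at 13 cells and graded RECORD tier («Σ is NOT obviously a theorem», crit-2 #23).  This file PROVES Σ's upper side on the whole
`K = 3` column: for every `m ≥ 3` and every support `d : Fin 3 → ℕ`, a real symmetric `m × m` three-term lacunary pencil whose determinant
lies in the sector (all roots real and simple) has degree `≤ 2⌊(m²+6m+1)/4⌋` (`= 14, 20, 28, 36, 46, 56, 68, …`).  Proof: the sieve at `r = 0`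
forces an exponent `0`; with values `{0,x,y}` the `m`-fold sums are `{q·x + s·y : q+s ≤ m}` and must be `2`-dense below the degree `n`;
`r = 1` forces `min(x,y) ≤ 2`; (i) `x = 1`: the sums are the intervals `[s·y, s·y + m − s]`, whose first DOUBLE gap sits after
`s₀ = m + 3 − y`, at height `≤ (m+2)²/4 + m + 1 < n − 1`; (ii) `x = 2`, `y = 2b`: the sums are `2·Σ'` for the two-denomination stamps `{1,b}`,
and STÖHR'S WITNESS (`stamps_two_denominations_all`, `…StampCeilingKThreeAll`) gives an odd/even double gap at `2r' − 1, 2r'` with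
`r' ≤ n(m,2) + 1` — this is the extremal branch (equality for `b = ⌊(m+3)/2⌋`, the doubled Stöhr basis); (iii) `x = 2`, `y` odd: the
step-`2` progressions `{2q + s·y}` stop chaining after `s* = m + 2 − (y+1)/2`, a double gap of height `2m + 2 + s*(y−2) ≤ (2m+1)²/8 + 2m + 2`,
which is `< n − 1` once `m ≥ 7`; the rows `m = 3, …, 6` are the kernel rows already landed (`…EtaThreeThree`, `…EtaKThree`,
`…EtaKThreeSixSeven`).  Result: `hypRootLawAt_K_three_all : ∀ m ≥ 3, HypRootLawAt m 3 (2 * ((m^2 + 6*m + 1)/4))`.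
The matching LOWER side (`σ` attained: `ν(m,3) = n(m,2)` realised) is in the kernel for `m = 3, 4, 5` only.  Nothing here bears on the crux
or on `VP ≠ VNP`.  [folklore] Elementary additive combinatorics (Stöhr's two-denomination bound); no citation is load-bearing.
-/

-- `Summit.ValiantsHypothesis.ValiantsHypothesis.…` repeats a component by the D-0017 layout
-- (single-conjunct summit), which the `dupNamespace` linter flags; the name is mandated.
set_option linter.dupNamespace false

namespace Summit.ValiantsHypothesis.ValiantsHypothesis.Theorems.LacunarySymmetroidMatrixDescartes.FiniteSector

open scoped BigOperators Matrix
open Polynomial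

/-! ## §1 Arithmetic helpers -/

/-- AM–GM in `ℕ`: `4ab ≤ (a+b)²`. [folklore] -/
theorem four_mul_le_sq_add (a b : ℕ) : 4 * (a * b) ≤ (a + b) * (a + b) := by
  zify
  nlinarith [sq_nonneg ((a : ℤ) - (b : ℤ))]

/-- The size of `n(m,2)`: `4·⌊(m²+6m+1)/4⌋ ≥ m² + 6m − 2`. [folklore] -/
theorem four_mul_stoehr_ge (m : ℕ) : m * m + 6 * m ≤ 4 * ((m ^ 2 + 6 * m + 1) / 4) + 2 := by
  have : m ^ 2 = m * m := by ring
  omega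

/-! ## §2 The three symbolic branches -/

/-- **Branch `x = 1`.**  Sums `q + s·y` (`q + s ≤ m`); for `m ≥ 3` no `2`-dense chain reaches `2⌊(m²+6m+1)/4⌋ + 1`. [folklore] -/
theorem sigmaK3_one (m y n : ℕ) (hm : 3 ≤ m) (hn : 2 * ((m ^ 2 + 6 * m + 1) / 4) + 1 ≤ n)
    (hmem : ∃ q s : ℕ, q + s ≤ m ∧ q * 1 + s * y = n)
    (hchain : ∀ r, r + 2 ≤ n → (∃ q s : ℕ, q + s ≤ m ∧ q * 1 + s * y = r) ∨
      (∃ q s : ℕ, q + s ≤ m ∧ q * 1 + s * y = r + 1)) : False := by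
  have hsq : m ^ 2 = m * m := by ring
  have hm3 : 3 * m ≤ m * m := Nat.mul_le_mul_right m hm
  have hN := four_mul_stoehr_ge m
  obtain ⟨q0, s0, hqs0, hn0⟩ := hmem
  rcases Nat.lt_or_ge y 3 with hy | hy
  · -- y ≤ 2: every sum ≤ 2m
    have : s0 * y ≤ s0 * 2 := Nat.mul_le_mul_left s0 (by omega)
    omega
  rcases Nat.lt_or_ge y (m + 4) with hy2 | hy2
  · -- 3 ≤ y ≤ m + 3 : t = y - 1, s₀ = m + 2 - t, double gap at r = s₀ t + m + 1
    obtain ⟨t, rfl⟩ : ∃ t, y = t + 1 := ⟨y - 1, by omega⟩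
    obtain ⟨s₀, hs₀⟩ : ∃ s₀, s₀ + t = m + 2 := ⟨m + 2 - t, by omega⟩
    have hgap : ∀ R, (R = s₀ * t + m + 1 ∨ R = s₀ * t + m + 2) →
        ¬ ∃ q s : ℕ, q + s ≤ m ∧ q * 1 + s * (t + 1) = R := by
      rintro R hR ⟨q, s, hqs, h⟩
      have hst : s * (t + 1) = s * t + s := by ring
      rcases Nat.lt_or_ge s (s₀ + 1) with hs | hs
      · have : s * t ≤ s₀ * t := Nat.mul_le_mul_right t (by omega)
        rcases hR with rfl | rfl <;> omega
      · have : (s₀ + 1) * t ≤ s * t := Nat.mul_le_mul_right t hs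
        have h2 : (s₀ + 1) * t = s₀ * t + t := by ring
        rcases hR with rfl | rfl <;> omega
    have hbound : 4 * (s₀ * t) ≤ (m + 2) * (m + 2) := by
      have := four_mul_le_sq_add s₀ t
      rw [hs₀] at this
      exact this
    have hexp : (m + 2) * (m + 2) = m * m + 4 * m + 4 := by ring
    rcases hchain (s₀ * t + m + 1) (by omega) with h | h
    · exact hgap _ (Or.inl rfl) h
    · exact hgap _ (Or.inr rfl) h
  · -- y ≥ m + 4: double gap at m + 1
    rcases hchain (m + 1) (by omega) with ⟨q, s, hqs, h⟩ | ⟨q, s, hqs, h⟩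
    · rcases Nat.eq_zero_or_pos s with hs | hs
      · subst hs; omega
      · have := Nat.le_mul_of_pos_left y hs; omega
    · rcases Nat.eq_zero_or_pos s with hs | hs
      · subst hs; omega
      · have := Nat.le_mul_of_pos_left y hs; omega

/-- **Branch `x = 2`, `y = 2b` even** (the extremal branch): Stöhr's witness for the stamps `{1, b}` doubles to an odd/even double gap.
[folklore] -/
theorem sigmaK3_two_even (m b n : ℕ) (hm : 1 ≤ m) (hn : 2 * ((m ^ 2 + 6 * m + 1) / 4) + 1 ≤ n)
    (hmem : ∃ q s : ℕ, q + s ≤ m ∧ q * 2 + s * (2 * b) = n)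
    (hchain : ∀ r, r + 2 ≤ n → (∃ q s : ℕ, q + s ≤ m ∧ q * 2 + s * (2 * b) = r) ∨
      (∃ q s : ℕ, q + s ≤ m ∧ q * 2 + s * (2 * b) = r + 1)) : False := by
  obtain ⟨r', hr', hnr⟩ := stamps_two_denominations_all m hm b
  obtain ⟨q0, s0, hqs0, hn0⟩ := hmem
  have h0 : s0 * (2 * b) = 2 * (s0 * b) := by ring
  have hne0 := hnr q0 s0 hqs0
  -- r' ≥ 1 (0 is representable)
  have hr1 : 1 ≤ r' := by
    by_contra h0'
    exact hnr 0 0 (by omega) (by simp; omega)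
  rcases Nat.lt_or_ge n (2 * r' + 1) with hsmall | hbig
  · -- n ≤ 2r': then n/2 = q0 + s0 b = r', contradiction
    omega
  · rcases hchain (2 * r' - 1) (by omega) with ⟨q, s, hqs, h⟩ | ⟨q, s, hqs, h⟩
    · have : s * (2 * b) = 2 * (s * b) := by ring
      omega
    · have : s * (2 * b) = 2 * (s * b) := by ring
      have := hnr q s hqs
      omega

/-- **Branch `x = 2`, `y` odd, `y ≥ 3`, `m ≥ 7`.**  The step-`2` progressions stop chaining after `s* = m + 2 − (y+1)/2`. [folklore] -/
theorem sigmaK3_two_odd (m y n : ℕ) (hm : 7 ≤ m) (hy3 : 3 ≤ y) (hodd : y % 2 = 1)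
    (hn : 2 * ((m ^ 2 + 6 * m + 1) / 4) + 1 ≤ n)
    (hmem : ∃ q s : ℕ, q + s ≤ m ∧ q * 2 + s * y = n)
    (hchain : ∀ r, r + 2 ≤ n → (∃ q s : ℕ, q + s ≤ m ∧ q * 2 + s * y = r) ∨
      (∃ q s : ℕ, q + s ≤ m ∧ q * 2 + s * y = r + 1)) : False := by
  have hsq : m ^ 2 = m * m := by ring
  have hN := four_mul_stoehr_ge m
  have hm7 : 7 * m ≤ m * m := Nat.mul_le_mul_right m hm
  obtain ⟨q0, s0, hqs0, hn0⟩ := hmem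
  rcases Nat.lt_or_ge y (2 * m + 3) with hy | hy
  · -- 3 ≤ y ≤ 2m + 1 (odd): w = y - 2, s* with 2 s* + w = 2m + 1
    obtain ⟨w, rfl⟩ : ∃ w, y = w + 2 := ⟨y - 2, by omega⟩
    obtain ⟨sS, hsS⟩ : ∃ sS, 2 * sS + w = 2 * m + 1 := ⟨(2 * m + 1 - w) / 2, by omega⟩
    have hgap : ∀ R, (R = 2 * m + 1 + sS * w ∨ R = 2 * m + 1 + sS * w + 1) →
        ¬ ∃ q s : ℕ, q + s ≤ m ∧ q * 2 + s * (w + 2) = R := by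
      rintro R hR ⟨q, s, hqs, h⟩
      have hsw : s * (w + 2) = s * w + 2 * s := by ring
      rcases Nat.lt_or_ge s (sS + 1) with hs | hs
      · have : s * w ≤ sS * w := Nat.mul_le_mul_right w (by omega)
        rcases hR with rfl | rfl <;> omega
      · have : (sS + 1) * w ≤ s * w := Nat.mul_le_mul_right w hs
        have h2 : (sS + 1) * w = sS * w + w := by ring
        rcases hR with rfl | rfl <;> omega
    have hbound : 4 * ((2 * sS) * w) ≤ (2 * m + 1) * (2 * m + 1) := by
      have := four_mul_le_sq_add (2 * sS) w
      rw [hsS] at this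
      exact this
    have hexp : (2 * m + 1) * (2 * m + 1) = 4 * (m * m) + 4 * m + 1 := by ring
    have h8 : (2 * sS) * w = 2 * (sS * w) := by ring
    rcases hchain (2 * m + 1 + sS * w) (by omega) with h | h
    · exact hgap _ (Or.inl rfl) h
    · exact hgap _ (Or.inr rfl) h
  · -- y ≥ 2m + 3: double gap at 2m + 1
    rcases hchain (2 * m + 1) (by omega) with ⟨q, s, hqs, h⟩ | ⟨q, s, hqs, h⟩
    · rcases Nat.eq_zero_or_pos s with hs | hs
      · subst hs; omega
      · have := Nat.le_mul_of_pos_left y hs; omega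
    · rcases Nat.eq_zero_or_pos s with hs | hs
      · subst hs; omega
      · have := Nat.le_mul_of_pos_left y hs; omega

/-! ## §3 Assembly: all `m ≥ 7` symbolically, `3 ≤ m ≤ 6` from the landed rows -/

/-- **Σ on the `K = 3` column, combinatorial form, `m ≥ 7`.** [folklore] -/
theorem sigmaK3 (m x y n : ℕ) (hm : 7 ≤ m) (hn : 2 * ((m ^ 2 + 6 * m + 1) / 4) + 1 ≤ n)
    (hmem : ∃ q s : ℕ, q + s ≤ m ∧ q * x + s * y = n)
    (hchain : ∀ r, r + 2 ≤ n → (∃ q s : ℕ, q + s ≤ m ∧ q * x + s * y = r) ∨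
      (∃ q s : ℕ, q + s ≤ m ∧ q * x + s * y = r + 1)) : False := by
  have hsq : m ^ 2 = m * m := by ring
  have hN := four_mul_stoehr_ge m
  have hm7 : 7 * m ≤ m * m := Nat.mul_le_mul_right m hm
  -- one denomination (a further value 0): y ≤ 2 by the chain at r = 1, n ≤ 2m
  have one_denom : ∀ a b : ℕ, a = 0 → (∃ q s : ℕ, q + s ≤ m ∧ q * a + s * b = n) →
      (∀ r, r + 2 ≤ n → (∃ q s : ℕ, q + s ≤ m ∧ q * a + s * b = r) ∨ (∃ q s : ℕ, q + s ≤ m ∧ q * a + s * b = r + 1)) → False := by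
    intro a b ha hmem' hch
    subst ha
    obtain ⟨q1, s1, hqs1, hn1⟩ := hmem'
    have hb : b ≤ 2 := by
      rcases hch 1 (by omega) with ⟨q, s, hqs, h⟩ | ⟨q, s, hqs, h⟩
      · rcases Nat.eq_zero_or_pos s with hs | hs
        · subst hs; omega
        · have := Nat.le_mul_of_pos_left b hs; omega
      · rcases Nat.eq_zero_or_pos s with hs | hs
        · subst hs; omega
        · have := Nat.le_mul_of_pos_left b hs; omega
    have : s1 * b ≤ s1 * 2 := Nat.mul_le_mul_left s1 hb
    omega
  rcases Nat.eq_zero_or_pos x with hx0 | hx1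
  · exact one_denom x y hx0 hmem hchain
  rcases Nat.eq_zero_or_pos y with hy0 | hy1
  · exact one_denom y x hy0 (inS_comm' hmem) (fun r hr => (hchain r hr).imp inS_comm' inS_comm')
  -- the branch with the smaller value in front
  have core : ∀ a b : ℕ, 1 ≤ a → a ≤ 2 → 1 ≤ b → (∃ q s : ℕ, q + s ≤ m ∧ q * a + s * b = n) →
      (∀ r, r + 2 ≤ n → (∃ q s : ℕ, q + s ≤ m ∧ q * a + s * b = r) ∨ (∃ q s : ℕ, q + s ≤ m ∧ q * a + s * b = r + 1)) → False := by
    intro a b ha1 ha2 hb1 hm' hch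
    interval_cases a
    · exact sigmaK3_one m b n (by omega) hn hm' hch
    · -- a = 2: b = 1 → swap to the x = 1 branch; b = 2 → one parity class ≤ 2m; b ≥ 3 even/odd
      rcases Nat.lt_or_ge b 3 with hb | hb
      · interval_cases b
        · exact sigmaK3_one m 2 n (by omega) hn (inS_comm' hm') (fun r hr => (hch r hr).imp inS_comm' inS_comm')
        · obtain ⟨q1, s1, hqs1, hn1⟩ := hm'
          omega
      rcases Nat.even_or_odd b with ⟨c, hc⟩ | ⟨c, hc⟩
      · -- b = c + c
        have hb2 : b = 2 * c := by omega
        subst hb2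
        exact sigmaK3_two_even m c n (by omega) hn hm' hch
      · exact sigmaK3_two_odd m b n hm hb (by omega) hn hm' hch
  have key : ∀ r, (∃ q s : ℕ, q + s ≤ m ∧ q * x + s * y = r) → r = 0 ∨ x ≤ r ∨ y ≤ r := by
    rintro r ⟨q, s, hqs, h⟩
    rcases Nat.eq_zero_or_pos q with hq | hq
    · rcases Nat.eq_zero_or_pos s with hs | hs
      · subst hq; subst hs; left; omega
      · have := Nat.le_mul_of_pos_left y hs; right; right; omega
    · have := Nat.le_mul_of_pos_left x hq; right; left; omega
  rcases Nat.lt_or_ge x 3 with hx3 | hx3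
  · exact core x y hx1 (by omega) hy1 hmem hchain
  rcases Nat.lt_or_ge y 3 with hy3 | hy3
  · exact core y x hy1 (by omega) hx1 (inS_comm' hmem) (fun r hr => (hchain r hr).imp inS_comm' inS_comm')
  rcases hchain 1 (by omega) with h | h
  · rcases key 1 h with h' | h' | h' <;> omega
  · rcases key 2 h with h' | h' | h' <;> omega

/-- **Σ on the `K = 3` column, pencil form, `m ≥ 7`.** [folklore] -/
theorem hypRootLawAt_K_three_of_ge_seven (m : ℕ) (hm : 7 ≤ m) : HypRootLawAt m 3 (2 * ((m ^ 2 + 6 * m + 1) / 4)) := by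
  intro d S hS hsec
  by_contra hdeg'
  have hdeg : 2 * ((m ^ 2 + 6 * m + 1) / 4) < (pencil d S).det.natDegree := not_le.mp hdeg'
  have hq : (pencil d S).det ≠ 0 := by
    intro h0
    rw [h0] at hdeg
    simp at hdeg
  have himage : ∀ r, r ∈ (Finset.univ : Finset (Sym (Fin 3) m)).image
      (fun s : Sym (Fin 3) m => ((s : Multiset (Fin 3)).map d).sum) →
      ∃ s : Multiset (Fin 3), Multiset.card s = m ∧ (s.map d).sum = r := by
    intro r hr
    rw [Finset.mem_image] at hr
    obtain ⟨s, -, hs⟩ := hr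
    exact ⟨(s : Multiset (Fin 3)), s.2, hs⟩
  have hsieve : ∀ r, r + 2 ≤ (pencil d S).det.natDegree →
      (∃ s : Multiset (Fin 3), Multiset.card s = m ∧ (s.map d).sum = r) ∨
      (∃ s : Multiset (Fin 3), Multiset.card s = m ∧ (s.map d).sum = r + 1) := by
    intro r hr
    rcases sieve d S hq hsec hr with h | h
    · exact Or.inl (himage r h)
    · exact Or.inr (himage (r + 1) h)
  have htop := himage _ (natDegree_mem_sumset d S hq)
  have hN := four_mul_stoehr_ge m
  have hm7 : 7 * m ≤ m * m := Nat.mul_le_mul_right m hm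
  obtain ⟨a, ha⟩ : ∃ a, d a = 0 := by
    rcases hsieve 0 (by omega) with ⟨s, hsc, hs⟩ | ⟨s, hsc, hs⟩
    · exact exists_eq_zero_of_sum_le_one d s (by omega) (by omega)
    · exact exists_eq_zero_of_sum_le_one d s (by omega) (by omega)
  obtain ⟨x, y, hxy⟩ := values_fin_three_zero d a ha
  have hIn : ∀ r, (∃ s : Multiset (Fin 3), Multiset.card s = m ∧ (s.map d).sum = r) →
      ∃ q t : ℕ, q + t ≤ m ∧ q * x + t * y = r := by
    rintro r ⟨s, hsc, hs⟩
    obtain ⟨q, t, hqt, hsum⟩ := sum_eq_stamps_zero d x y hxy s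
    exact ⟨q, t, by omega, by omega⟩
  have hdeg2 : 2 * ((m ^ 2 + 6 * m + 1) / 4) + 1 ≤
      (Matrix.det (∑ l, ((Polynomial.X : ℝ[X]) ^ d l) • (S l).map Polynomial.C)).natDegree := hdeg
  exact sigmaK3 m x y _ hm hdeg2 (hIn _ htop) (fun r hr => (hsieve r hr).imp (hIn r) (hIn (r + 1)))

/-- **CONJECTURE Σ ON THE `K = 3` COLUMN (kernel, all `m ≥ 3`): `η(m,3) ≤ 2⌊(m²+6m+1)/4⌋ = 2·n(m,2) = σ(m,3)`** — every real symmetric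
`m × m` lacunary pencil with three terms whose determinant lies in the sector has degree at most twice Stöhr's two-denomination stamp
number; ALL supports `d : Fin 3 → ℕ`.  (`m = 3..6`: the landed rows `14, 20, 28, 36`; `m ≥ 7`: `hypRootLawAt_K_three_of_ge_seven`.)
[folklore] -/
theorem hypRootLawAt_K_three_all (m : ℕ) (hm : 3 ≤ m) : HypRootLawAt m 3 (2 * ((m ^ 2 + 6 * m + 1) / 4)) := by
  rcases Nat.lt_or_ge m 7 with h7 | h7
  · interval_cases m
    · exact hypRootLawAt_three_three_14
    · exact hypRootLawAt_four_three_20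
    · exact hypRootLawAt_five_three_28
    · exact hypRootLawAt_six_three_36
  · exact hypRootLawAt_K_three_of_ge_seven m h7

end Summit.ValiantsHypothesis.ValiantsHypothesis.Theorems.LacunarySymmetroidMatrixDescartes.FiniteSector
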